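import Summits.ValiantsHypothesis.ValiantsHypothesis.Theorems.LacunarySymmetroidMatrixDescartesCensusExteriorTangent

/-!
# `MatrixDescartes` census — the EXTERIOR-TANGENT LAW for pencils: Euler form `(x f')² ≤ 4 f g` at the deepest point of a return excursion

HONEST FRAMING.  Object-search cell `pub-symmetroid`, door-A seat `val-sym-door-p1` (g13); helper beside the OPEN typed statements
`DoorA26 = PosRootLawAt 2 6 19` (stmt-ValiantsHypothesis-19979) and `DoorA34` (19980), asserted nowhere.  Companion of
`…CensusExteriorTangent` (the law for `C¹` paths of symmetric `2 × 2` matrices): here it is specialised to real symmetric `2 × 2`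
PENCILS `F(x) = Σ_l x^{d_l} S_l` of ANY length `K` on ANY support `d`, in EULER FORM — the derivative pencil is replaced by
`E(x) = x·F'(x) = Σ_l d_l x^{d_l} S_l`, a pencil on the SAME support with letters `d_l S_l` (the tangent line of the projective curve
`[F(x)]` is spanned by `F(x)` and `E(x)` alike).  Statement (`exteriorTangent_pencil`): on every gap `0 < α < β` of `det F` with
`det F < 0` inside and positive-semidefinite rank-one ends (`tr F(α), tr F(β) > 0`; the negative case by `S ↦ −S`) there is
`x₀ ∈ (α, β)` with the critical relation `tr F·D = 2 det F·tr E` (`D = A_E C + A C_E − 2 B B_E = x₀ f'(x₀)` the polarised determinant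
of `F(x₀), E(x₀)`), `det(E − μF)·tr² F ≤ det F·tr²(E − μF)` and `det(E(x₀) − μF(x₀)) ≤ 0` for every real `μ`, the QUADRATIC ROOT-SIDE
ROW `D² ≤ 4·det F(x₀)·det E(x₀)` — for `K = 6` and a 2-Sidon support: `(x f')² ≤ 4 f g` for the three `21`-nomials `f = Σ c_k x^{e_k}`,
`x f' = Σ e_k c_k x^{e_k}`, `g = det E = Σ d_i d_j c_{ij} x^{d_i + d_j}` — and `det E(x₀) ≤ 0`.  Entry-sum bookkeeping
(`pencilTwo_apply`, `det_pencilTwo`, `trace_pencilTwo`, `hasDerivAt_pencilEntry`, Euler's identity `mul_deriv_pencilEntry`) is included so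
that users holding the matrix form `(Σ_l x^{d_l} • S_l).det` can rewrite.  Nothing here bounds `ζ_sym(2,6)`/`ζ_sym(3,4)`, decides
`DoorA26`/`DoorA34`, or bears on `MatrixDescartes` (stmt-ValiantsHypothesis-18050) / `VP ≠ VNP`.

CORRECTION to the located (non-kernel) remark in the module docstring of `…CensusExteriorTangent` (its theorems are unaffected):
the leading-order two-term reading of the row at a breakpoint between a positive monomial `c_U x^{s_U}` and the negative window
monomial `c_V x^{s_V}` is NOT «`|s_V − s_U| ≥ δ_U + δ_V`»; the correct computation is
`4fg − (xf')² = −δ_U² A² − δ_V² B² + ((s_V − s_U)² − δ_U² − δ_V²)·AB` (`A = c_U x^{s_U} > 0 > B = c_V x^{s_V}`, `A + B < 0`), which can be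
`≥ 0` only if `|s_V − s_U| ≤ |δ_U − δ_V|` and — with the side condition `A < |B|` and the `μ`-family evaluated at the letters —
only if the letter interval of the NEGATIVE pair `V` lies inside the letter interval of the POSITIVE pair `U` (strictly inside: feasible
on an interior window of ratios `A/|B|`; sharing an endpoint: borderline, decided at the next order).  Consecutive pairs of a chamber
order are always nested or endpoint-sharing, so at leading order the law is an ORIENTED NESTING / RATIO row, not a sign row; the seat
report (DOOR-A-P1-REPORT §63–§65) records the located census of this reading over the 2 608 chambers and its check on the census
eighteens (at every deepest point the dominant positive pair's letter interval contains the dominant negative pair's).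

[folklore] Term-wise differentiation of a finite sum of monomials, Euler's identity `x·(x^n)' = n x^n`, and the companion law; elementary.
-/

-- `Summit.ValiantsHypothesis.ValiantsHypothesis.…` repeats a component by the D-0017 layout
-- (single-conjunct summit), which the `dupNamespace` linter flags; the name is mandated.
set_option linter.dupNamespace false

namespace Summit.ValiantsHypothesis.ValiantsHypothesis.Theorems.LacunarySymmetroidMatrixDescartes.Census

open Set Finset
open scoped BigOperators Topology

/-! ### 4. Pencils `F(x) = Σ_l x^{d_l} S_l` and the EULER PENCIL `E(x) = x·F'(x) = Σ_l d_l x^{d_l} S_l` (any length `K`, any support) -/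

section Pencil

variable {K : ℕ}

/-- The entry functions `x ↦ Σ_l x^{d_l} s_l` of a pencil are differentiable, with derivative `Σ_l d_l x^{d_l − 1} s_l`. [folklore] -/
theorem hasDerivAt_pencilEntry (d : Fin K → ℕ) (s : Fin K → ℝ) (x : ℝ) :
    HasDerivAt (fun y => ∑ l, y ^ d l * s l) (∑ l, (d l : ℝ) * x ^ (d l - 1) * s l) x := by
  exact HasDerivAt.fun_sum (u := Finset.univ) (A := fun l y => y ^ d l * s l)
    (A' := fun l => (d l : ℝ) * x ^ (d l - 1) * s l) (x := x)
    (fun l _ => (hasDerivAt_pow (d l) x).mul_const (s l))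

/-- Euler's identity for the entry functions: `x · (Σ_l x^{d_l} s_l)' = Σ_l d_l x^{d_l} s_l`. [folklore] -/
theorem mul_deriv_pencilEntry (d : Fin K → ℕ) (s : Fin K → ℝ) (x : ℝ) :
    x * (∑ l, (d l : ℝ) * x ^ (d l - 1) * s l) = ∑ l, (d l : ℝ) * x ^ d l * s l := by
  rw [Finset.mul_sum]
  refine Finset.sum_congr rfl fun l _ => ?_
  rcases Nat.eq_zero_or_pos (d l) with h | h
  · simp [h]
  · have e : x * x ^ (d l - 1) = x ^ d l := by
      rw [← pow_succ', Nat.sub_add_cancel h]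
    calc x * ((d l : ℝ) * x ^ (d l - 1) * s l) = (d l : ℝ) * (x * x ^ (d l - 1)) * s l := by ring
      _ = (d l : ℝ) * x ^ d l * s l := by rw [e]

/-- Entries of an evaluated pencil: `(Σ_l x^{d_l} • S_l) i j = Σ_l x^{d_l} (S_l) i j`. [folklore] -/
theorem pencilTwo_apply (d : Fin K → ℕ) (S : Fin K → Matrix (Fin 2) (Fin 2) ℝ) (x : ℝ) (i j : Fin 2) :
    (∑ l, x ^ d l • S l) i j = ∑ l, x ^ d l * S l i j := by
  simp [Matrix.sum_apply]

/-- Entries of the evaluated Euler pencil: `(Σ_l (d_l x^{d_l}) • S_l) i j = Σ_l d_l x^{d_l} (S_l) i j`. [folklore] -/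
theorem eulerPencilTwo_apply (d : Fin K → ℕ) (S : Fin K → Matrix (Fin 2) (Fin 2) ℝ) (x : ℝ) (i j : Fin 2) :
    (∑ l, ((d l : ℝ) * x ^ d l) • S l) i j = ∑ l, (d l : ℝ) * x ^ d l * S l i j := by
  simp [Matrix.sum_apply]

/-- Determinant of an evaluated symmetric `2 × 2` pencil in terms of its three entry sums. [folklore] -/
theorem det_pencilTwo (d : Fin K → ℕ) (S : Fin K → Matrix (Fin 2) (Fin 2) ℝ) (hS : ∀ l, (S l).IsSymm) (x : ℝ) :
    (∑ l, x ^ d l • S l).det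
      = (∑ l, x ^ d l * S l 0 0) * (∑ l, x ^ d l * S l 1 1) - (∑ l, x ^ d l * S l 0 1) ^ 2 := by
  have h10 : ∀ l, S l 1 0 = S l 0 1 := fun l => by
    have := (hS l).apply 0 1; simpa using this
  rw [Matrix.det_fin_two, pencilTwo_apply, pencilTwo_apply, pencilTwo_apply, pencilTwo_apply]
  simp only [h10]
  ring

/-- Trace of an evaluated `2 × 2` pencil in terms of its entry sums. [folklore] -/
theorem trace_pencilTwo (d : Fin K → ℕ) (S : Fin K → Matrix (Fin 2) (Fin 2) ℝ) (x : ℝ) :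
    (∑ l, x ^ d l • S l).trace = (∑ l, x ^ d l * S l 0 0) + (∑ l, x ^ d l * S l 1 1) := by
  rw [Matrix.trace_fin_two, pencilTwo_apply, pencilTwo_apply]

/-- **EXTERIOR-TANGENT LAW for symmetric `2 × 2` pencils (any length `K`, any support `d`), Euler form.**  Write
`A, B, C` for the entry sums `Σ_l x^{d_l}(S_l)₀₀, Σ_l x^{d_l}(S_l)₀₁, Σ_l x^{d_l}(S_l)₁₁` of `F(x) = Σ_l x^{d_l} S_l` and `A_E, B_E, C_E`
for those of the Euler pencil `E(x) = x F'(x) = Σ_l d_l x^{d_l} S_l` (same support, letters `d_l S_l`).  On a gap `0 < α < β` with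
`det F(α) = det F(β) = 0`, `det F < 0` on `(α, β)`, `tr F(α) > 0`, `tr F(β) > 0`, there is `x₀ ∈ (α, β)` with the critical relation
`tr F · D = 2 det F · tr E` (`D = A_E C + A C_E − 2 B B_E = x f'(x₀)`, the polarised determinant), the pencil inequality
`det(E − μF) tr² F ≤ det F · tr²(E − μF)` for all `μ`, `det(E(x₀) − μ F(x₀)) ≤ 0` for all `μ`, the QUADRATIC ROW `D² ≤ 4 det F · det E`
(i.e. `(x f')² ≤ 4 f g` for the `21`-nomials `f = det F`, `g = det E` when `K = 6`), and `det E(x₀) ≤ 0`. [folklore] -/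
theorem exteriorTangent_pencil (d : Fin K → ℕ) (S : Fin K → Matrix (Fin 2) (Fin 2) ℝ) {α β : ℝ} (hα : 0 < α) (hαβ : α < β)
    (hfα : (∑ l, α ^ d l * S l 0 0) * (∑ l, α ^ d l * S l 1 1) - (∑ l, α ^ d l * S l 0 1) ^ 2 = 0)
    (hfβ : (∑ l, β ^ d l * S l 0 0) * (∑ l, β ^ d l * S l 1 1) - (∑ l, β ^ d l * S l 0 1) ^ 2 = 0)
    (hneg : ∀ x ∈ Ioo α β, (∑ l, x ^ d l * S l 0 0) * (∑ l, x ^ d l * S l 1 1) - (∑ l, x ^ d l * S l 0 1) ^ 2 < 0)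
    (hTα : 0 < (∑ l, α ^ d l * S l 0 0) + (∑ l, α ^ d l * S l 1 1))
    (hTβ : 0 < (∑ l, β ^ d l * S l 0 0) + (∑ l, β ^ d l * S l 1 1)) :
    ∃ x₀ ∈ Ioo α β,
      ((∑ l, x₀ ^ d l * S l 0 0) + (∑ l, x₀ ^ d l * S l 1 1)) *
          ((∑ l, (d l : ℝ) * x₀ ^ d l * S l 0 0) * (∑ l, x₀ ^ d l * S l 1 1)
            + (∑ l, x₀ ^ d l * S l 0 0) * (∑ l, (d l : ℝ) * x₀ ^ d l * S l 1 1)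
            - 2 * (∑ l, x₀ ^ d l * S l 0 1) * (∑ l, (d l : ℝ) * x₀ ^ d l * S l 0 1))
        = 2 * ((∑ l, x₀ ^ d l * S l 0 0) * (∑ l, x₀ ^ d l * S l 1 1) - (∑ l, x₀ ^ d l * S l 0 1) ^ 2)
            * ((∑ l, (d l : ℝ) * x₀ ^ d l * S l 0 0) + (∑ l, (d l : ℝ) * x₀ ^ d l * S l 1 1)) ∧
      (∀ μ : ℝ,
        (((∑ l, (d l : ℝ) * x₀ ^ d l * S l 0 0) - μ * (∑ l, x₀ ^ d l * S l 0 0))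
            * ((∑ l, (d l : ℝ) * x₀ ^ d l * S l 1 1) - μ * (∑ l, x₀ ^ d l * S l 1 1))
          - ((∑ l, (d l : ℝ) * x₀ ^ d l * S l 0 1) - μ * (∑ l, x₀ ^ d l * S l 0 1)) ^ 2)
          * ((∑ l, x₀ ^ d l * S l 0 0) + (∑ l, x₀ ^ d l * S l 1 1)) ^ 2
        ≤ ((∑ l, x₀ ^ d l * S l 0 0) * (∑ l, x₀ ^ d l * S l 1 1) - (∑ l, x₀ ^ d l * S l 0 1) ^ 2)
          * (((∑ l, (d l : ℝ) * x₀ ^ d l * S l 0 0) + (∑ l, (d l : ℝ) * x₀ ^ d l * S l 1 1))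
              - μ * ((∑ l, x₀ ^ d l * S l 0 0) + (∑ l, x₀ ^ d l * S l 1 1))) ^ 2) ∧
      (∀ μ : ℝ,
        ((∑ l, (d l : ℝ) * x₀ ^ d l * S l 0 0) - μ * (∑ l, x₀ ^ d l * S l 0 0))
            * ((∑ l, (d l : ℝ) * x₀ ^ d l * S l 1 1) - μ * (∑ l, x₀ ^ d l * S l 1 1))
          - ((∑ l, (d l : ℝ) * x₀ ^ d l * S l 0 1) - μ * (∑ l, x₀ ^ d l * S l 0 1)) ^ 2 ≤ 0) ∧
      ((∑ l, (d l : ℝ) * x₀ ^ d l * S l 0 0) * (∑ l, x₀ ^ d l * S l 1 1)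
          + (∑ l, x₀ ^ d l * S l 0 0) * (∑ l, (d l : ℝ) * x₀ ^ d l * S l 1 1)
          - 2 * (∑ l, x₀ ^ d l * S l 0 1) * (∑ l, (d l : ℝ) * x₀ ^ d l * S l 0 1)) ^ 2
        ≤ 4 * ((∑ l, x₀ ^ d l * S l 0 0) * (∑ l, x₀ ^ d l * S l 1 1) - (∑ l, x₀ ^ d l * S l 0 1) ^ 2)
            * ((∑ l, (d l : ℝ) * x₀ ^ d l * S l 0 0) * (∑ l, (d l : ℝ) * x₀ ^ d l * S l 1 1)
                - (∑ l, (d l : ℝ) * x₀ ^ d l * S l 0 1) ^ 2) ∧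
      (∑ l, (d l : ℝ) * x₀ ^ d l * S l 0 0) * (∑ l, (d l : ℝ) * x₀ ^ d l * S l 1 1)
          - (∑ l, (d l : ℝ) * x₀ ^ d l * S l 0 1) ^ 2 ≤ 0 := by
  -- the entry functions and their derivatives
  obtain ⟨x₀, hx₀, -, hcrit⟩ := exteriorTangent_gap
    (a := fun y => ∑ l, y ^ d l * S l 0 0) (b := fun y => ∑ l, y ^ d l * S l 0 1) (c := fun y => ∑ l, y ^ d l * S l 1 1)
    (a' := fun y => ∑ l, (d l : ℝ) * y ^ (d l - 1) * S l 0 0) (b' := fun y => ∑ l, (d l : ℝ) * y ^ (d l - 1) * S l 0 1)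
    (c' := fun y => ∑ l, (d l : ℝ) * y ^ (d l - 1) * S l 1 1)
    (hasDerivAt_pencilEntry d (fun l => S l 0 0)) (hasDerivAt_pencilEntry d (fun l => S l 0 1))
    (hasDerivAt_pencilEntry d (fun l => S l 1 1)) hαβ hfα hfβ hneg hTα hTβ
  have hx0 : 0 < x₀ := lt_trans hα hx₀.1
  have hf := hneg x₀ hx₀
  -- Euler form of the critical relation: multiply by `x₀` and use `x · F' = E`
  have eA := mul_deriv_pencilEntry d (fun l => S l 0 0) x₀
  have eB := mul_deriv_pencilEntry d (fun l => S l 0 1) x₀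
  have eC := mul_deriv_pencilEntry d (fun l => S l 1 1) x₀
  have hcritE : ((∑ l, x₀ ^ d l * S l 0 0) + (∑ l, x₀ ^ d l * S l 1 1)) *
          ((∑ l, (d l : ℝ) * x₀ ^ d l * S l 0 0) * (∑ l, x₀ ^ d l * S l 1 1)
            + (∑ l, x₀ ^ d l * S l 0 0) * (∑ l, (d l : ℝ) * x₀ ^ d l * S l 1 1)
            - 2 * (∑ l, x₀ ^ d l * S l 0 1) * (∑ l, (d l : ℝ) * x₀ ^ d l * S l 0 1))
        = 2 * ((∑ l, x₀ ^ d l * S l 0 0) * (∑ l, x₀ ^ d l * S l 1 1) - (∑ l, x₀ ^ d l * S l 0 1) ^ 2)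
            * ((∑ l, (d l : ℝ) * x₀ ^ d l * S l 0 0) + (∑ l, (d l : ℝ) * x₀ ^ d l * S l 1 1)) := by
    rw [← eA, ← eB, ← eC]
    linear_combination x₀ * hcrit
  refine ⟨x₀, hx₀, hcritE, fun μ => exteriorTangent_alg _ _ _ _ _ _ μ hf hcritE,
    fun μ => exteriorTangent_alg_nonpos _ _ _ _ _ _ μ hf hcritE, exteriorTangent_alg_disc _ _ _ _ _ _ hf hcritE, ?_⟩
  have h := exteriorTangent_alg_nonpos _ _ _ _ _ _ 0 hf hcritE
  simpa using h

end Pencil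

end Summit.ValiantsHypothesis.ValiantsHypothesis.Theorems.LacunarySymmetroidMatrixDescartes.Census
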